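import Literature.Computability.Cryptography.ClassBQP
import Literature.Computability.Complexity.Randomized
import Literature.Computability.Complexity.BoolEncodings
import Mathlib.Computability.Encoding
import Mathlib.NumberTheory.NumberField.ClassNumber
import Mathlib.NumberTheory.NumberField.Units.Regulator
import HarnessLib

/-!
# The class-group stage of the pure cubic class-number algorithm: the goal, named (definitions)

Topic `Computability/Cryptography`; DEFINITIONS ONLY (named `Prop`s). The registered umbrella stub `stub_classStage` of the line
`arakelov-giant-step-cycle` (crux `LinnikCubicClassGroups.PureCubicClassGroupFBQP`) concludes a conjunction of four statements about
the CLASS-GROUP STAGE given correct regulator advice — a polynomial-time query map, classical pre/post-processing in `FP` and ONE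
uniform oracle-free quantum circuit family that, on an admissible instance `w = ⟨x, (f,a,b), ps⟩` and advice `r` with
`|r − 2^k R_K| ≤ 1`, outputs the order of the subgroup of `Cl(𝓞_K)` generated by the degree-one primes above `ps` with probability
`≥ 11/12` (`ClassStageMain`), plus two format inclusions (`ClassStageIncl₁/₂`) and the convexity of the advice relation
(`ClassStageConvex`). Naming them lets the stage's assembly stub ("table program + table semantics + sampling law + post-processor ⇒
stage") and its short registered handle be stated under the registry's length cap; the texts are VERBATIM the registered ones.
[Hallgren 2005, §4]

## References

* S. Hallgren, STOC 2005, §4. [Hallgren2005]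
-/

noncomputable section

namespace Literature.Computability.Cryptography

namespace CubicClassStage

open _root_.Computability (encodeNat decodeNat)
open Literature.Computability.Complexity
open scoped NumberField nonZeroDivisors

/-- **The class-group stage succeeds** (query map, pre/post-processing, one uniform oracle-free family, success `≥ 11/12` on
admissible instances with correct regulator advice). [cite: Hallgren2005, §4] -/
def ClassStageMain : Prop :=
  ∃ qry : List Bool → List Bool, qry ∈ FP ∧
      (∀ w, (fun w : List Bool => ∃ (x : List Bool) (f a b : ℕ) (ps : List ℕ), w = boolPair x (boolPair (boolPair (encodeNat f) (boolPair (encodeNat a) (encodeNat b))) (encodingListNatBool.encode ps)) ∧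
        decodeNat x = f ^ 3 * (a * b ^ 2) ∧ Squarefree (a * b) ∧ (∀ r : ℕ, r ^ 3 ≠ decodeNat x) ∧
        ∀ p ∈ ps, p.Prime ∧ ¬ p ∣ 3 * decodeNat x) w →
        (fun q : List Bool => ∃ (x : List Bool) (f a b k : ℕ), q = boolPair (boolPair x (boolPair (encodeNat f) (boolPair (encodeNat a) (encodeNat b)))) (List.replicate k true) ∧
        decodeNat x = f ^ 3 * (a * b ^ 2) ∧ Squarefree (a * b) ∧ ∀ r : ℕ, r ^ 3 ≠ decodeNat x) (qry w)) ∧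
      ∃ (pre post : List Bool → List Bool), pre ∈ FP ∧ post ∈ FP ∧
        ∃ F : QCircuitFamily cliffordT, F.IsOracleFree ∧ F.IsUniform ∧
          ∀ (w : List Bool) (r : ℕ), (fun w : List Bool => ∃ (x : List Bool) (f a b : ℕ) (ps : List ℕ), w = boolPair x (boolPair (boolPair (encodeNat f) (boolPair (encodeNat a) (encodeNat b))) (encodingListNatBool.encode ps)) ∧
        decodeNat x = f ^ 3 * (a * b ^ 2) ∧ Squarefree (a * b) ∧ (∀ r : ℕ, r ^ 3 ≠ decodeNat x) ∧
        ∀ p ∈ ps, p.Prime ∧ ¬ p ∣ 3 * decodeNat x) w →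
            (fun (q : List Bool) (r : ℕ) => ∀ (x : List Bool) (f a b k : ℕ), q = boolPair (boolPair x (boolPair (encodeNat f) (boolPair (encodeNat a) (encodeNat b)))) (List.replicate k true) →
        decodeNat x = f ^ 3 * (a * b ^ 2) → Squarefree (a * b) →
        ∀ (K : Type) [Field K] [NumberField K], Module.finrank ℚ K = 3 →
          (∀ r' : ℕ, r' ^ 3 ≠ decodeNat x) → (∃ α : K, α ^ 3 = (decodeNat x : K)) →
          |(r : ℝ) - 2 ^ k * NumberField.Units.regulator K| ≤ 1) (qry w) r →
            (11 : ℝ) / 12 ≤ F.kernelProb 0 (pre (boolPair w (encodeNat r)))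
              {y | (fun (w o : List Bool) => ∀ (x : List Bool) (f a b : ℕ) (ps : List ℕ), w = boolPair x (boolPair (boolPair (encodeNat f) (boolPair (encodeNat a) (encodeNat b))) (encodingListNatBool.encode ps)) →
        decodeNat x = f ^ 3 * (a * b ^ 2) → Squarefree (a * b) →
        ∀ (K : Type) [Field K] [NumberField K], Module.finrank ℚ K = 3 →
          (∀ r : ℕ, r ^ 3 ≠ decodeNat x) → (∃ α : K, α ^ 3 = (decodeNat x : K)) →
          (∀ p ∈ ps, p.Prime ∧ ¬ p ∣ 3 * decodeNat x) →
          o = encodeNat (Nat.card (Subgroup.closure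
            {c : ClassGroup (𝓞 K) | ∃ p ∈ ps, ∃ P : Ideal (𝓞 K), ∃ hP : P ∈ nonZeroDivisors (Ideal (𝓞 K)),
              P.IsPrime ∧ Ideal.absNorm P = p ∧ c = ClassGroup.mk0 ⟨P, hP⟩}))) w (post (boolPair (boolPair w (encodeNat r)) y))}

/-- **Format inclusion 1**: the regulator relation refines the advice relation. [folklore] -/
def ClassStageIncl₁ : Prop :=
  ∀ (q : List Bool) (y : List Bool), y ∈ (fun w => {y | ∀ (x : List Bool) (f a b k : ℕ),
      w = boolPair (boolPair x (boolPair (encodeNat f) (boolPair (encodeNat a) (encodeNat b)))) (List.replicate k true) →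
      decodeNat x = f ^ 3 * (a * b ^ 2) → Squarefree (a * b) →
      ∀ (K : Type) [Field K] [NumberField K], Module.finrank ℚ K = 3 →
        (∀ r : ℕ, r ^ 3 ≠ decodeNat x) → (∃ α : K, α ^ 3 = (decodeNat x : K)) →
        ∃ (r : ℕ) (t : List Bool), y = boolPair (encodeNat r) t ∧
          |(r : ℝ) - 2 ^ k * NumberField.Units.regulator K| ≤ 1}) q →
      y ∈ {y | (fun q : List Bool => ∃ (x : List Bool) (f a b k : ℕ), q = boolPair (boolPair x (boolPair (encodeNat f) (boolPair (encodeNat a) (encodeNat b)))) (List.replicate k true) ∧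
        decodeNat x = f ^ 3 * (a * b ^ 2) ∧ Squarefree (a * b) ∧ ∀ r : ℕ, r ^ 3 ≠ decodeNat x) q → ∃ (r : ℕ) (t : List Bool), y = boolPair (encodeNat r) t ∧ (fun (q : List Bool) (r : ℕ) => ∀ (x : List Bool) (f a b k : ℕ), q = boolPair (boolPair x (boolPair (encodeNat f) (boolPair (encodeNat a) (encodeNat b)))) (List.replicate k true) →
        decodeNat x = f ^ 3 * (a * b ^ 2) → Squarefree (a * b) →
        ∀ (K : Type) [Field K] [NumberField K], Module.finrank ℚ K = 3 →
          (∀ r' : ℕ, r' ^ 3 ≠ decodeNat x) → (∃ α : K, α ^ 3 = (decodeNat x : K)) →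
          |(r : ℝ) - 2 ^ k * NumberField.Units.regulator K| ≤ 1) q r}

/-- **Format inclusion 2**: the chain's goal refines the crux's output relation. [folklore] -/
def ClassStageIncl₂ : Prop :=
  ∀ (w : List Bool) (z : List Bool),
      z ∈ {z | (fun w : List Bool => ∃ (x : List Bool) (f a b : ℕ) (ps : List ℕ), w = boolPair x (boolPair (boolPair (encodeNat f) (boolPair (encodeNat a) (encodeNat b))) (encodingListNatBool.encode ps)) ∧
        decodeNat x = f ^ 3 * (a * b ^ 2) ∧ Squarefree (a * b) ∧ (∀ r : ℕ, r ^ 3 ≠ decodeNat x) ∧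
        ∀ p ∈ ps, p.Prime ∧ ¬ p ∣ 3 * decodeNat x) w → ∃ (o t : List Bool), z = boolPair o t ∧ (fun (w o : List Bool) => ∀ (x : List Bool) (f a b : ℕ) (ps : List ℕ), w = boolPair x (boolPair (boolPair (encodeNat f) (boolPair (encodeNat a) (encodeNat b))) (encodingListNatBool.encode ps)) →
        decodeNat x = f ^ 3 * (a * b ^ 2) → Squarefree (a * b) →
        ∀ (K : Type) [Field K] [NumberField K], Module.finrank ℚ K = 3 →
          (∀ r : ℕ, r ^ 3 ≠ decodeNat x) → (∃ α : K, α ^ 3 = (decodeNat x : K)) →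
          (∀ p ∈ ps, p.Prime ∧ ¬ p ∣ 3 * decodeNat x) →
          o = encodeNat (Nat.card (Subgroup.closure
            {c : ClassGroup (𝓞 K) | ∃ p ∈ ps, ∃ P : Ideal (𝓞 K), ∃ hP : P ∈ nonZeroDivisors (Ideal (𝓞 K)),
              P.IsPrime ∧ Ideal.absNorm P = p ∧ c = ClassGroup.mk0 ⟨P, hP⟩}))) w o} → z ∈ (fun w => {y | ∀ (x : List Bool) (f a b : ℕ) (ps : List ℕ),
        w = boolPair x (boolPair (boolPair (encodeNat f) (boolPair (encodeNat a) (encodeNat b))) (encodingListNatBool.encode ps)) →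
        decodeNat x = f ^ 3 * (a * b ^ 2) → Squarefree (a * b) →
        ∀ (K : Type) [Field K] [NumberField K], Module.finrank ℚ K = 3 →
          (∀ r : ℕ, r ^ 3 ≠ decodeNat x) → (∃ α : K, α ^ 3 = (decodeNat x : K)) →
          (∀ p ∈ ps, p.Prime ∧ ¬ p ∣ 3 * decodeNat x) →
          ∃ t : List Bool, y = boolPair (encodeNat (Nat.card (Subgroup.closure
            {c : ClassGroup (𝓞 K) | ∃ p ∈ ps, ∃ P : Ideal (𝓞 K), ∃ hP : P ∈ nonZeroDivisors (Ideal (𝓞 K)),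
              P.IsPrime ∧ Ideal.absNorm P = p ∧ c = ClassGroup.mk0 ⟨P, hP⟩}))) t}) w

/-- **Convexity of the advice relation** in the advice value. [folklore] -/
def ClassStageConvex : Prop :=
  ∀ (q : List Bool) (r₁ r₂ r : ℕ), (fun (q : List Bool) (r : ℕ) => ∀ (x : List Bool) (f a b k : ℕ), q = boolPair (boolPair x (boolPair (encodeNat f) (boolPair (encodeNat a) (encodeNat b)))) (List.replicate k true) →
        decodeNat x = f ^ 3 * (a * b ^ 2) → Squarefree (a * b) →
        ∀ (K : Type) [Field K] [NumberField K], Module.finrank ℚ K = 3 →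
          (∀ r' : ℕ, r' ^ 3 ≠ decodeNat x) → (∃ α : K, α ^ 3 = (decodeNat x : K)) →
          |(r : ℝ) - 2 ^ k * NumberField.Units.regulator K| ≤ 1) q r₁ → (fun (q : List Bool) (r : ℕ) => ∀ (x : List Bool) (f a b k : ℕ), q = boolPair (boolPair x (boolPair (encodeNat f) (boolPair (encodeNat a) (encodeNat b)))) (List.replicate k true) →
        decodeNat x = f ^ 3 * (a * b ^ 2) → Squarefree (a * b) →
        ∀ (K : Type) [Field K] [NumberField K], Module.finrank ℚ K = 3 →
          (∀ r' : ℕ, r' ^ 3 ≠ decodeNat x) → (∃ α : K, α ^ 3 = (decodeNat x : K)) →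
          |(r : ℝ) - 2 ^ k * NumberField.Units.regulator K| ≤ 1) q r₂ → r₁ ≤ r → r ≤ r₂ → (fun (q : List Bool) (r : ℕ) => ∀ (x : List Bool) (f a b k : ℕ), q = boolPair (boolPair x (boolPair (encodeNat f) (boolPair (encodeNat a) (encodeNat b)))) (List.replicate k true) →
        decodeNat x = f ^ 3 * (a * b ^ 2) → Squarefree (a * b) →
        ∀ (K : Type) [Field K] [NumberField K], Module.finrank ℚ K = 3 →
          (∀ r' : ℕ, r' ^ 3 ≠ decodeNat x) → (∃ α : K, α ^ 3 = (decodeNat x : K)) →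
          |(r : ℝ) - 2 ^ k * NumberField.Units.regulator K| ≤ 1) q r

/-- **The goal of the class-group stage** (the registered umbrella stub's conclusion, named). [cite: Hallgren2005, §4] -/
def ClassStageGoal : Prop :=
  ClassStageMain ∧ ClassStageIncl₁ ∧ ClassStageIncl₂ ∧ ClassStageConvex

/-- **The named fact `ClassStageConvex` HOLDS**: the good advice values `r` form an interval — if `r₁` and `r₂` are
within `1` of `2^k · Reg(K)` and `r₁ ≤ r ≤ r₂`, so is `r` (two applications of `abs_le` and linear arithmetic).
EXACT-name Literature-side discharge; twin of the Summits-side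
`Summit.QuantumAdvantage.QuantumAdvantage.Theorems.LinnikCubicClassGroups.classStage_convex` (verbatim proof, re-homed by
the Hodge foundations lane `lit-hodgefound`, seat p20, generation 38); the advice-format bookkeeping of the class-group
stage of Hallgren's algorithm. [cite: Hallgren2005, §4] -/
theorem ClassStageConvex_holds : ClassStageConvex := by
  intro q r₁ r₂ r h₁ h₂ h1r hr2 x f a b k hq hdec hsq K _ _ hdeg hnc hα
  have e₁ := h₁ x f a b k hq hdec hsq K hdeg hnc hα
  have e₂ := h₂ x f a b k hq hdec hsq K hdeg hnc hα
  rw [abs_le] at e₁ e₂ ⊢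
  have c1 : (r₁ : ℝ) ≤ r := by exact_mod_cast h1r
  have c2 : (r : ℝ) ≤ r₂ := by exact_mod_cast hr2
  constructor <;> linarith [e₁.1, e₂.2]

end CubicClassStage

end Literature.Computability.Cryptography
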